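import Summits.QuantumFields.GaugeBoot.WordLinkRP
import HarnessLib

/-!
# Gauge-boot / ym-instrument: spatial loops on the time axis (vocabulary and geometry for time correlators)

Cell `ym-instrument` (HUMAN RULING D-0084 (2); director-ym R138; HOME `run/shared/lean/pub/ym-instrument/`), crew (a),
Lean typist seat `ym-instrument-boot-lean-1`; file 1/3 of the answer to the pre-registered question **Q-A2 (α)** of
`pub/ym-instrument/QUESTIONS.md` («positivity-only lower bound on the connected plaquette–plaquette correlator decay at
fixed β»; BOOT-PLAN §5.1, run-list item R-A2.0, 0 core-h). It inherits the word layer of cell `pub-gaugeboot`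
(`LatticeWords`, `WordLoop`, `WordSymmetry`, `WordSiteRP`, `WordLinkRP`).

HONEST FRAMING (page 1 of every file of this cell): this file certifies NOTHING numerically and contains no number; it
is vocabulary and lattice geometry. The instrument cell produces certified bounds on lattice expectations at STATED
`(G, D, L, β)`; NOT a mass gap, NOT a continuum limit, NOT a string tension; nothing here is summit-bearing.

## Content (torus `(ℤ/L)^d`, any group `G`, representation `ρ`)
* `Word.isSpatial w` (Boolean): no step of `w` is along the time axis `0`; `Word.isSpatial_plaquette` (`i, j ≠ 0`),
  `Word.isSpatial_nil`; a spatial word is fixed by the step reflection `θ'` (`Word.map_reflect0_of_isSpatial`) and,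
  read from an integer site of time `0 ≤ t ≤ B` (`1 ≤ t ≤ B`), lies in the closed positive half of the site
  reflection (`Word.siteHalfOK_of_isSpatial`) resp. consists of positive-time links (`Word.linkHalfOK_of_isSpatial`).
* `tSite t = (t, 0⃗)` (cast mod `L`): additive; `negReflect_tSite : θ'(t,0⃗) = (-t,0⃗)`;
  `timeReflect_tSite : θ(t,0⃗) = (1-t,0⃗)`.
* Loop variables `W_{(t,0⃗)}(w)` (`wordLoop ρ (tSite t) w`) of a spatial word: observables of the closed positive half
  for `0 ≤ t ≤ L/2` (`dependsOn_wordLoop_tSite`), positive-time for `1 ≤ t ≤ L/2`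
  (`isPositiveTimeObservable_wordLoop_tSite`); the two reflections act by `t ↦ -t` / `t ↦ 1 - t`
  (`wordLoop_tSite_negReflect`, `wordLoop_tSite_timeReflect`); translation invariance of pair expectations
  `⟨W_x(v) W_y(w)⟩ = ⟨W_{x+z}(v) W_{y+z}(w)⟩` (`wilsonExpectation_wordLoop_mul_translate`, tree
  `wilsonExpectation_comp_torusConfigShift`); integrability of products.
* Real forms of the two Osterwalder–Seiler reflection positivities of the tree: `0 ≤ ⟨f(Θ'U) f(U)⟩` for a real
  bounded measurable `f` on the closed positive half, any real `β` (`wilsonExpectation_negReflect_mul_self_nonneg`,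
  from `wilsonExpectation_siteReflectionPositive`), and `0 ≤ ⟨f(ΘU) f(U)⟩` for positive-time `f`, `β ≥ 0`
  (`wilsonExpectation_timeReflect_mul_self_nonneg`, from `wilsonExpectation_reflectionPositive_holds`).

Files 2/3 (`SpatialLoopHankel`: the Hankel blocks) and 3/3 (`PlaquettePairRP`: the connected plaquette–plaquette
correlator) build on this. References: K. Osterwalder, E. Seiler, Ann. Phys. 110 (1978) 440, §2; E. Seiler, LNP 159
(1982) Ch. 2; Montvay–Münster, *Quantum Fields on a Lattice* (1994) §3.2.6 (positivity of the transfer matrix from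
reflection positivity). Everything here is `[folklore]`.
-/

noncomputable section

open MeasureTheory ComplexConjugate
open scoped ComplexOrder
open Literature.MathematicalPhysics.QuantumFieldTheory
open Literature.RepresentationTheory.CompactGroups

namespace Summit.QuantumFields.GaugeBoot

/-! ## Spatial words and the sites `(t, 0⃗)` of the time axis -/

namespace Word

variable {d : ℕ} [NeZero d]

/-- A word is SPATIAL when none of its steps is along the time axis `0` (Boolean, `decide`). [folklore] -/
def isSpatial (w : Word d) : Bool := w.all fun s => decide (s.axis ≠ 0)

/-- Unfolding `isSpatial`: every step has a non-zero axis. [folklore] -/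
theorem isSpatial_iff (w : Word d) : isSpatial w = true ↔ ∀ s ∈ w, s.axis ≠ 0 := by
  simp [isSpatial, List.all_eq_true]

/-- The plaquette word in a plane `(i, j)` with `i, j ≠ 0` is spatial. [folklore] -/
theorem isSpatial_plaquette {i j : Fin d} (hi : i ≠ 0) (hj : j ≠ 0) : isSpatial (plaquette i j) = true := by
  rw [isSpatial_iff]
  intro s hs
  simp only [plaquette, List.mem_cons, List.not_mem_nil, or_false] at hs
  rcases hs with rfl | rfl | rfl | rfl <;> simpa

/-- The empty word is spatial. [folklore] -/
theorem isSpatial_nil : isSpatial ([] : Word d) = true := rfl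

/-- The tail of a spatial word is spatial and its head is a spatial step. [folklore] -/
theorem isSpatial_cons {s : Step d} {w : Word d} (h : isSpatial (s :: w) = true) :
    s.axis ≠ 0 ∧ isSpatial w = true := by
  simpa [isSpatial, List.all_cons] using h

/-- A spatial step does not move the time coordinate. [folklore] -/
theorem disp_apply_zero_of_axis_ne {s : Step d} (hs : s.axis ≠ 0) : s.disp 0 = 0 := by
  cases s with
  | fwd μ => simp only [Step.axis_fwd] at hs; simp [Step.disp, Pi.single_eq_of_ne (Ne.symm hs)]
  | bwd μ => simp only [Step.axis_bwd] at hs; simp [Step.disp, Pi.single_eq_of_ne (Ne.symm hs)]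

/-- A spatial step is fixed by the reflection of axis `0`. [folklore] -/
theorem reflect0_of_axis_ne {s : Step d} (hs : s.axis ≠ 0) : s.reflect0 = s := by
  cases s with
  | fwd μ => simp only [Step.axis_fwd] at hs; simp [Step.reflect0, hs]
  | bwd μ => simp only [Step.axis_bwd] at hs; simp [Step.reflect0, hs]

/-- A spatial word is fixed by the reflection of axis `0`. [folklore] -/
theorem map_reflect0_of_isSpatial {w : Word d} (hw : isSpatial w = true) : w.map Step.reflect0 = w := by
  induction w with
  | nil => rfl
  | cons s w ih =>
    obtain ⟨hs, hw'⟩ := isSpatial_cons hw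
    rw [List.map_cons, reflect0_of_axis_ne hs, ih hw']

/-- A spatial word read from an integer site of time `0 ≤ y₀ ≤ B` lies in the closed positive half of
height `B` (site reflection). [folklore] -/
theorem siteHalfOK_of_isSpatial {B : ℕ} :
    ∀ {w : Word d}, isSpatial w = true → ∀ {y : Fin d → ℤ}, 0 ≤ y 0 → y 0 ≤ B → siteHalfOK B w y = true
  | [], _, _, _, _ => rfl
  | s :: w, hw, y, h0, hB => by
    obtain ⟨hs, hw'⟩ := isSpatial_cons hw
    have hstep : stepSiteOK B y s = true := by
      cases s with
      | fwd μ => simp only [Step.axis_fwd] at hs; simp [stepSiteOK, hs, h0, hB]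
      | bwd μ => simp only [Step.axis_bwd] at hs; simp [stepSiteOK, hs, h0, hB]
    have hy : (y + s.disp) 0 = y 0 := by rw [Pi.add_apply, disp_apply_zero_of_axis_ne hs, add_zero]
    rw [siteHalfOK, hstep, Bool.true_and]
    exact siteHalfOK_of_isSpatial hw' (by rw [hy]; exact h0) (by rw [hy]; exact hB)

/-- A spatial word read from an integer site of time `1 ≤ y₀ ≤ B` consists of positive-time links of height
`≤ B` (link reflection). [folklore] -/
theorem linkHalfOK_of_isSpatial {B : ℕ} :
    ∀ {w : Word d}, isSpatial w = true → ∀ {y : Fin d → ℤ}, 1 ≤ y 0 → y 0 ≤ B → linkHalfOK B w y = true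
  | [], _, _, _, _ => rfl
  | s :: w, hw, y, h0, hB => by
    obtain ⟨hs, hw'⟩ := isSpatial_cons hw
    have hstep : stepLinkOK B y s = true := by
      cases s with
      | fwd μ => simp only [Step.axis_fwd] at hs; simp [stepLinkOK, hs, h0, hB]
      | bwd μ => simp only [Step.axis_bwd] at hs; simp [stepLinkOK, hs, h0, hB]
    have hy : (y + s.disp) 0 = y 0 := by rw [Pi.add_apply, disp_apply_zero_of_axis_ne hs, add_zero]
    rw [linkHalfOK, hstep, Bool.true_and]
    exact linkHalfOK_of_isSpatial hw' (by rw [hy]; exact h0) (by rw [hy]; exact hB)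

end Word

section TimeAxis

variable {d L : ℕ} [NeZero d]

/-- The site `(t, 0⃗)` of the torus `(ℤ/L)^d` at integer time `t` (cast mod `L`). [folklore] -/
def tSite (t : ℤ) : Site d L := castZ (Pi.single 0 t)

/-- Unfolding lemma: `tSite t = castZ (t e₀)`. [folklore] -/
theorem tSite_eq (t : ℤ) : (tSite t : Site d L) = castZ (Pi.single 0 t) := rfl

/-- `tSite 0` is the origin. [folklore] -/
@[simp] theorem tSite_zero : (tSite 0 : Site d L) = 0 := by
  simp [tSite]

/-- The time coordinate of `tSite t`. [folklore] -/
@[simp] theorem tSite_apply_zero (t : ℤ) : (tSite t : Site d L) 0 = (t : ZMod L) := by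
  simp [tSite, castZ]

/-- The spatial coordinates of `tSite t` vanish. [folklore] -/
theorem tSite_apply_of_ne (t : ℤ) {k : Fin d} (hk : k ≠ 0) : (tSite t : Site d L) k = 0 := by
  simp [tSite, castZ, Pi.single_eq_of_ne hk]

/-- `tSite` is additive. [folklore] -/
theorem tSite_add (s t : ℤ) : (tSite (s + t) : Site d L) = tSite s + tSite t := by
  rw [tSite, tSite, tSite, ← castZ_add, ← Pi.single_add]

/-- `tSite` is compatible with negation. [folklore] -/
theorem tSite_neg (t : ℤ) : (tSite (-t) : Site d L) = -tSite t := by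
  rw [tSite, tSite, ← castZ_neg, ← Pi.single_neg]

/-- `tSite` is compatible with subtraction. [folklore] -/
theorem tSite_sub (s t : ℤ) : (tSite (s - t) : Site d L) = tSite s - tSite t := by
  rw [sub_eq_add_neg, tSite_add, tSite_neg, ← sub_eq_add_neg]

/-- The site reflection `θ' : x₀ ↦ -x₀` on the time axis. [folklore] -/
theorem negReflect_tSite (t : ℤ) : ((tSite t : Site d L)).negReflect = tSite (-t) := by
  funext k
  by_cases hk : k = 0
  · subst hk; simp [Site.negReflect]
  · rw [WilsonSiteRP.negReflect_apply_of_ne _ hk, tSite_apply_of_ne _ hk, tSite_apply_of_ne _ hk]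

/-- The link reflection `θ : x₀ ↦ 1 - x₀` on the time axis. [folklore] -/
theorem timeReflect_tSite (t : ℤ) : ((tSite t : Site d L)).timeReflect = tSite (1 - t) := by
  funext k
  by_cases hk : k = 0
  · subst hk; simp [Site.timeReflect]
  · rw [WilsonRP.timeReflect_apply_of_ne _ hk, tSite_apply_of_ne _ hk, tSite_apply_of_ne _ hk]

end TimeAxis

/-! ## Reflection positivity for real scalar observables -/

section RealRP

variable {d L N : ℕ} [NeZero d] [NeZero L] {G : Type*} [Group G] [TopologicalSpace G]
  [IsTopologicalGroup G] [CompactSpace G] [MeasurableSpace G] [BorelSpace G]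
  (ρ : G →* Matrix (Fin N) (Fin N) ℂ)

/-- **Site reflection positivity for a real observable**: `0 ≤ ⟨f(Θ'U) f(U)⟩_β` for `L` even, any real
`β`, and `f` bounded measurable depending on the links of the closed positive half (tree
`wilsonExpectation_siteReflectionPositive`, real form). [folklore] -/
theorem wilsonExpectation_negReflect_mul_self_nonneg (hL : Even L) (hρ : Continuous ρ) (β : ℝ)
    (f : GaugeConfig d L G → ℝ) (hf : Measurable f) (hfb : ∃ C : ℝ, ∀ U, |f U| ≤ C)
    (hfdep : DependsOn f
      ((WilsonSiteRP.sitePosEdges ∪ WilsonSiteRP.sharedEdges : Finset (Edge d L)) : Set (Edge d L))) :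
    0 ≤ wilsonExpectation ρ β fun U => f U.negReflect * f U := by
  obtain ⟨C, hC⟩ := hfb
  have h := wilsonExpectation_siteReflectionPositive ρ hL hρ β (fun U => (f U : ℂ))
    (Complex.measurable_ofReal.comp hf) ⟨C, fun U => by rw [Complex.norm_real, Real.norm_eq_abs]; exact hC U⟩
    (fun U V hUV => by simp only [hfdep hUV])
  have hid : (fun U : GaugeConfig d L G => conj ((f U.negReflect : ℝ) : ℂ) * (f U : ℂ)) =
      fun U => ((f U.negReflect * f U : ℝ) : ℂ) := by
    funext U; rw [Complex.conj_ofReal, Complex.ofReal_mul]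
  rw [hid] at h
  unfold wilsonExpectation at h ⊢
  rw [integral_complex_ofReal] at h
  exact Complex.zero_le_real.1 h

/-- **Link reflection positivity for a real observable**: `0 ≤ ⟨f(ΘU) f(U)⟩_β` for `L` even, `β ≥ 0`, and
`f` bounded measurable positive-time (tree `wilsonExpectation_reflectionPositive_holds`, real form). [folklore] -/
theorem wilsonExpectation_timeReflect_mul_self_nonneg (hL : Even L) (hρ : Continuous ρ) {β : ℝ} (hβ : 0 ≤ β)
    (f : GaugeConfig d L G → ℝ) (hf : Measurable f) (hfb : ∃ C : ℝ, ∀ U, |f U| ≤ C)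
    (hfpos : IsPositiveTimeObservable f) :
    0 ≤ wilsonExpectation ρ β fun U => f U.timeReflect * f U := by
  obtain ⟨C, hC⟩ := hfb
  have h := wilsonExpectation_reflectionPositive_holds ρ hL hρ hβ (fun U => (f U : ℂ))
    (Complex.measurable_ofReal.comp hf) ⟨C, fun U => by rw [Complex.norm_real, Real.norm_eq_abs]; exact hC U⟩
    (fun U V hUV => by simp only [hfpos U V hUV])
  have hid : (fun U : GaugeConfig d L G => (starRingEnd ℂ) ((f U.timeReflect : ℝ) : ℂ) * (f U : ℂ)) =
      fun U => ((f U.timeReflect * f U : ℝ) : ℂ) := by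
    funext U; rw [Complex.conj_ofReal, Complex.ofReal_mul]
  rw [hid] at h
  unfold wilsonExpectation at h ⊢
  rw [integral_complex_ofReal] at h
  exact Complex.zero_le_real.1 h

end RealRP

/-! ## Loop variables of spatial words on the time axis: support, reflections, translation -/

section SpatialLoops

variable {d L N : ℕ} [NeZero d] [NeZero L] {G : Type*} [Group G] [TopologicalSpace G]
  [IsTopologicalGroup G] [CompactSpace G] [MeasurableSpace G] [BorelSpace G]
  (ρ : G →* Matrix (Fin N) (Fin N) ℂ)

omit [NeZero L] [TopologicalSpace G] [IsTopologicalGroup G] [CompactSpace G] [MeasurableSpace G] [BorelSpace G] in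
/-- The loop variable of a spatial word read from `(t, 0⃗)`, `0 ≤ t ≤ L/2`, is an observable of the closed positive
half of the site reflection. [folklore] -/
theorem dependsOn_wordLoop_tSite [NeZero L] {w : Word d} (hw : w.isSpatial = true) {t : ℕ} (ht : t ≤ L / 2) :
    DependsOn (wordLoop (G := G) ρ (tSite (t : ℤ) : Site d L) w)
      ((WilsonSiteRP.sitePosEdges ∪ WilsonSiteRP.sharedEdges : Finset (Edge d L)) : Set (Edge d L)) :=
  dependsOn_wordHolonomy (fun g => (N : ℝ)⁻¹ * (ρ g).trace.re) (tSite (t : ℤ)) w _ fun k hk =>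
    Finset.mem_coe.2 (edge_mem_of_siteHalfOK (d := d) (L := L) (B := L / 2) (by omega) w (Pi.single 0 (t : ℤ))
      (Word.siteHalfOK_of_isSpatial hw (by simp) (by simp only [Pi.single_eq_same]; exact_mod_cast ht)) k hk)

omit [TopologicalSpace G] [IsTopologicalGroup G] [CompactSpace G] [MeasurableSpace G] [BorelSpace G] in
/-- The loop variable of a spatial word read from `(t, 0⃗)`, `1 ≤ t ≤ L/2`, is a positive-time observable of the
link reflection. [folklore] -/
theorem isPositiveTimeObservable_wordLoop_tSite [Fact (1 < L)] {w : Word d} (hw : w.isSpatial = true) {t : ℕ}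
    (h1 : 1 ≤ t) (ht : t ≤ L / 2) :
    IsPositiveTimeObservable (wordLoop (G := G) ρ (tSite (t : ℤ) : Site d L) w) := by
  intro U V hUV
  simp only [wordLoop]
  rw [wordHolonomy_congr (tSite (t : ℤ)) w fun k hk => ?_]
  obtain ⟨h₁, h₂, h₃, h₄⟩ := isPosEdge_of_linkHalfOK (d := d) (L := L) (B := L / 2) (by omega) w
    (Pi.single 0 (t : ℤ)) (Word.linkHalfOK_of_isSpatial hw (by simp only [Pi.single_eq_same]; exact_mod_cast h1)
      (by simp only [Pi.single_eq_same]; exact_mod_cast ht)) k hk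
  exact hUV _ h₁ h₂ h₃ h₄

omit [NeZero L] [TopologicalSpace G] [IsTopologicalGroup G] [CompactSpace G] [MeasurableSpace G] [BorelSpace G] in
/-- Site reflection moves a spatial loop along the time axis: `W_{(t,0⃗)}(w)(Θ'U) = W_{(-t,0⃗)}(w)(U)`. [folklore] -/
theorem wordLoop_tSite_negReflect {w : Word d} (hw : w.isSpatial = true) (t : ℤ) (U : GaugeConfig d L G) :
    wordLoop ρ (tSite t : Site d L) w U.negReflect = wordLoop ρ (tSite (-t) : Site d L) w U := by
  simp only [wordLoop, wordHolonomy_negReflect, negReflect_tSite, Word.map_reflect0_of_isSpatial hw]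

omit [NeZero L] [TopologicalSpace G] [IsTopologicalGroup G] [CompactSpace G] [MeasurableSpace G] [BorelSpace G] in
/-- Link reflection moves a spatial loop along the time axis: `W_{(t,0⃗)}(w)(ΘU) = W_{(1-t,0⃗)}(w)(U)`. [folklore] -/
theorem wordLoop_tSite_timeReflect {w : Word d} (hw : w.isSpatial = true) (t : ℤ) (U : GaugeConfig d L G) :
    wordLoop ρ (tSite t : Site d L) w U.timeReflect = wordLoop ρ (tSite (1 - t) : Site d L) w U := by
  simp only [wordLoop, wordHolonomy_timeReflect, timeReflect_tSite, Word.map_reflect0_of_isSpatial hw]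

omit [NeZero d] in
open TorusTranslation in
/-- **Translation invariance of pair expectations**: `⟨W_x(v) W_y(w)⟩ = ⟨W_{x+z}(v) W_{y+z}(w)⟩` (tree
`wilsonExpectation_comp_torusConfigShift`). [folklore] -/
theorem wilsonExpectation_wordLoop_mul_translate (β : ℝ) (x y z : Site d L) (v w : Word d) :
    wilsonExpectation ρ β (fun U : GaugeConfig d L G => wordLoop ρ x v U * wordLoop ρ y w U) =
      wilsonExpectation ρ β (fun U : GaugeConfig d L G => wordLoop ρ (x + z) v U * wordLoop ρ (y + z) w U) := by
  have h := wilsonExpectation_comp_torusConfigShift (d := d) (L := L) (G := G) ρ β z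
    (fun U : GaugeConfig d L G => wordLoop ρ (x + z) v U * wordLoop ρ (y + z) w U)
  have h' : ((fun U : GaugeConfig d L G => wordLoop ρ (x + z) v U * wordLoop ρ (y + z) w U) ∘ torusConfigShift z) =
      fun U => wordLoop ρ x v U * wordLoop ρ y w U := by
    funext U; simp only [Function.comp_apply, wordLoop, wordHolonomy_torusConfigShift, add_sub_cancel_right]
  rw [h'] at h
  exact h

omit [NeZero d] in
/-- Products of loop variables are integrable (bounded by `1`, measurable). [folklore] -/
theorem integrable_wordLoop_mul (hρ : Continuous ρ) (β : ℝ) (x y : Site d L) (v w : Word d) :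
    Integrable (fun U : GaugeConfig d L G => wordLoop ρ x v U * wordLoop ρ y w U) (wilsonMeasure ρ β) := by
  haveI := isProbabilityMeasure_wilsonMeasure (d := d) (L := L) (G := G) ρ hρ β
  refine Integrable.of_bound ((measurable_wordLoop ρ hρ x v).mul (measurable_wordLoop ρ hρ y w)).aestronglyMeasurable
    1 (ae_of_all _ fun U => ?_)
  rw [Real.norm_eq_abs, abs_mul]
  exact mul_le_one₀ (abs_wordLoop_le_one ρ hρ x v U) (abs_nonneg _) (abs_wordLoop_le_one ρ hρ y w U)

omit [NeZero d] in
/-- Bilinear expansion of the expectation of a product of two finite linear combinations. [folklore] -/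
theorem wilsonExpectation_sum_mul_sum (β : ℝ) {ι : Type*} (T : Finset ι) (c : ι → ℝ)
    (F K : ι → GaugeConfig d L G → ℝ)
    (hFK : ∀ p ∈ T, ∀ q ∈ T, Integrable (fun U => F p U * K q U) (wilsonMeasure ρ β)) :
    wilsonExpectation ρ β (fun U : GaugeConfig d L G => (∑ p ∈ T, c p * F p U) * ∑ q ∈ T, c q * K q U) =
      ∑ p ∈ T, ∑ q ∈ T, c p * c q * wilsonExpectation ρ β (fun U : GaugeConfig d L G => F p U * K q U) := by
  have hpt : (fun U : GaugeConfig d L G => (∑ p ∈ T, c p * F p U) * ∑ q ∈ T, c q * K q U) =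
      fun U => ∑ p ∈ T, ∑ q ∈ T, c p * c q * (F p U * K q U) := by
    funext U
    rw [Finset.sum_mul_sum]
    exact Finset.sum_congr rfl fun p _ => Finset.sum_congr rfl fun q _ => by ring
  unfold wilsonExpectation
  rw [hpt, integral_finsetSum _ fun p hp => integrable_finsetSum _ fun q hq => (hFK p hp q hq).const_mul _]
  refine Finset.sum_congr rfl fun p hp => ?_
  rw [integral_finsetSum _ fun q hq => (hFK p hp q hq).const_mul _]
  refine Finset.sum_congr rfl fun q _ => ?_
  rw [integral_const_mul]

end SpatialLoops

end Summit.QuantumFields.GaugeBoot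

end
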